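import Summits.Ventures.LatticeQCDFlow.Exactness.Phi4HMCFluctuationRelation
import Mathlib.Analysis.Convex.Integral
import Mathlib.Analysis.Convex.SpecificFunctions.Basic
import Mathlib.MeasureTheory.Function.L2Space
import HarnessLib

/-!
# Acceptance from the mean energy violation, model-free: `1 − ⟨P_acc⟩ ≤ √(1 − e^{−⟨ΔH⟩}) ≤ √⟨ΔH⟩`

HONEST FRAMING: exact (Metropolis-corrected) sampling algorithms for lattice gauge theory;
figures of merit are autocorrelation/cost numbers at stated couplings and volumes; no
continuum-physics claim.  (SCALAR calibration rung S0-A: not a gauge result.)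

Venture `LatticeQCDFlow` (cell pub-lqcd), topic `Exactness`; FANOUT row 2 (`s0-phi4`: the HMC arm
of the 2D φ⁴ calibration — the acceptance and `dH` columns of the exactness battery).  NEW WORK of
the cell over Mathlib (Jensen `ConvexOn.map_integral_le`, Hölder `integral_mul_le_Lp_mul_Lq_of_nonneg`)
and row 2's `Exactness/Phi4HMCFluctuationRelation.lean`; nothing is cited as a fact.  Printed
counterparts, named only: Creutz 1988 (`⟨e^{−ΔH}⟩ = 1 ⇒ ⟨ΔH⟩ ≥ 0`), Gupta–Irbäck–Karsch–Petersson
1990 / Kennedy–Pendleton 1991 (`⟨P_acc⟩ ≈ erfc(½√⟨ΔH⟩)`, a GAUSSIAN-model statement), and for the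
inequality itself Bretagnolle–Huber 1979 / Le Cam (total variation vs. Kullback–Leibler:
`TV ≤ √(1 − e^{−KL})`), of which this is the instance `TV(π, Ψ_*π) = 1 − ⟨P_acc⟩`, `KL = ⟨ΔH⟩`.

## What is proved

* §1 (any probability space `(X, π)`, any measurable "energy violation" `D` with `e^{−D}` and `D`
  integrable and CREUTZ'S IDENTITY `∫ e^{−D} dπ = 1` — volume preservation is enough, no Gaussian
  model, no reversibility):
  `one_sub_integral_min_eq_half_integral_abs` — `1 − ∫ min(1, e^{−D}) = ½ ∫ |1 − e^{−D}|`;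
  `exp_neg_half_integral_le` — Jensen, `e^{−⟨D⟩/2} ≤ ∫ e^{−D/2}`;
  **`one_sub_acceptance_le_sqrt`** — `1 − ∫ min(1, e^{−D}) dπ ≤ √(1 − e^{−∫ D dπ})`
  (Cauchy–Schwarz on `|1 − e^{−D}| = |1 − e^{−D/2}|·(1 + e^{−D/2})`, then Jensen), and the weaker
  but memorable **`one_sub_acceptance_le_sqrt_mean`** — `1 − ⟨P_acc⟩ ≤ √⟨D⟩`; also
  `integral_nonneg_of_creutz` — `0 ≤ ⟨D⟩` (Creutz's inequality, Jensen).
* §2 (row 2's framework of `Phi4HMCFluctuationRelation.lean`: `(X, μ)`, `Ψ` a measurable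
  `μ`-preserving involution, weight `e^{−H}` with `Z = ∫ e^{−H} dμ`, `ΔH = deltaH H Ψ`):
  **`involutive_acceptance_ge`** — if `ΔH·e^{−H}` is integrable then
  `∫ min(1, e^{−ΔH}) e^{−H} dμ ≥ (1 − √(1 − e^{−⟨ΔH⟩})) · Z`, `⟨ΔH⟩ = Z⁻¹ ∫ ΔH e^{−H} dμ` — for
  EVERY deterministic reversible proposal (HMC with any volume-preserving reversible integrator,
  any trajectory length), in particular row 2's lattice HMC (`hmc_acceptance_ge`, stated with the
  first-moment integrability as an explicit hypothesis).

Reading for the battery (no numerics implied): an HMC row reporting mean acceptance `a` and mean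
energy violation `m = mean(dH)` in equilibrium must satisfy `a ≥ 1 − √(1 − e^{−m})` up to
statistics (e.g. `m = 0.02 ⇒ a ≥ 0.859`; the Gaussian model predicts `erfc(√0.02/2) = 0.920`), a
model-free consistency check between two stored columns; a violation flags a non-equilibrated or
non-volume-preserving run.  NOT CLAIMED: the `erfc` law (a statement about a Gaussian MODEL of
`ΔH`), upper bounds on the acceptance, anything about autocorrelations.
-/

namespace Summit.Ventures.LatticeQCDFlow.Exactness

open Real MeasureTheory Filter

/-! ## §1 A probability space with Creutz's identity -/

section Probability

variable {X : Type*} [MeasurableSpace X] {ν : Measure X} [IsProbabilityMeasure ν] {D : X → ℝ}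

/-- `1 − ∫ min(1, e^{−D}) = ∫ (1 − e^{−D})⁺`: the rejected mass is the positive part of `1 − e^{−D}`. -/
theorem one_sub_integral_min_eq (hDm : Measurable D) :
    1 - ∫ x, min 1 (Real.exp (-D x)) ∂ν = ∫ x, max (1 - Real.exp (-D x)) 0 ∂ν := by
  have hmin_int : Integrable (fun x => min (1 : ℝ) (Real.exp (-D x))) ν := by
    refine Integrable.mono' (integrable_const (1 : ℝ))
      (measurable_const.min (Real.measurable_exp.comp hDm.neg)).aestronglyMeasurable
      (Eventually.of_forall fun x => ?_)
    rw [Real.norm_eq_abs, abs_of_nonneg (le_min zero_le_one (Real.exp_pos _).le)]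
    exact min_le_left _ _
  have hpt : ∀ x, max (1 - Real.exp (-D x)) 0 = 1 - min 1 (Real.exp (-D x)) := by
    intro x
    rcases le_total 1 (Real.exp (-D x)) with h | h
    · rw [min_eq_left h, max_eq_right (by linarith), sub_self]
    · rw [min_eq_right h, max_eq_left (by linarith)]
  simp_rw [hpt]
  rw [integral_sub (integrable_const _) hmin_int, integral_const, probReal_univ, one_smul]

/-- **Half the `L¹` distance.**  Under Creutz's identity `∫ e^{−D} = 1`:
`1 − ∫ min(1, e^{−D}) = ½ ∫ |1 − e^{−D}|` (the positive and negative parts of `1 − e^{−D}` have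
equal mass). -/
theorem one_sub_integral_min_eq_half_integral_abs (hDm : Measurable D)
    (hE : Integrable (fun x => Real.exp (-D x)) ν) (hcreutz : ∫ x, Real.exp (-D x) ∂ν = 1) :
    1 - ∫ x, min 1 (Real.exp (-D x)) ∂ν = (1 / 2) * ∫ x, |1 - Real.exp (-D x)| ∂ν := by
  rw [one_sub_integral_min_eq hDm]
  have hpt : ∀ x, max (1 - Real.exp (-D x)) 0
      = (1 / 2) * |1 - Real.exp (-D x)| + (1 / 2) * (1 - Real.exp (-D x)) := by
    intro x
    rcases le_total 0 (1 - Real.exp (-D x)) with h | h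
    · rw [max_eq_left h, abs_of_nonneg h]; ring
    · rw [max_eq_right h, abs_of_nonpos h]; ring
  simp_rw [hpt]
  have h1 : Integrable (fun x => 1 - Real.exp (-D x)) ν := (integrable_const _).sub hE
  have habs : Integrable (fun x => |1 - Real.exp (-D x)|) ν := h1.abs
  rw [integral_add (habs.const_mul _) (h1.const_mul _), integral_const_mul, integral_const_mul,
    integral_sub (integrable_const _) hE, integral_const, probReal_univ, one_smul, hcreutz]
  ring

/-- **Jensen**: `e^{−⟨D⟩/2} ≤ ∫ e^{−D/2} dπ`. -/
theorem exp_neg_half_integral_le (hD : Integrable D ν)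
    (hs : Integrable (fun x => Real.exp (-D x / 2)) ν) :
    Real.exp (-(∫ x, D x ∂ν) / 2) ≤ ∫ x, Real.exp (-D x / 2) ∂ν := by
  have h := ConvexOn.map_integral_le (μ := ν) (g := Real.exp) (s := Set.univ)
    (f := fun x => -D x / 2) convexOn_exp Real.continuous_exp.continuousOn isClosed_univ
    (Eventually.of_forall fun _ => Set.mem_univ _) ((hD.neg).div_const 2) hs
  have e : ∫ x, -D x / 2 ∂ν = -(∫ x, D x ∂ν) / 2 := by
    rw [integral_div, integral_neg]
  rw [e] at h
  exact h

/-- **Creutz's inequality** `0 ≤ ⟨D⟩` from `∫ e^{−D} = 1` (Jensen). -/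
theorem integral_nonneg_of_creutz (hD : Integrable D ν) (hE : Integrable (fun x => Real.exp (-D x)) ν)
    (hcreutz : ∫ x, Real.exp (-D x) ∂ν = 1) : 0 ≤ ∫ x, D x ∂ν := by
  have h := ConvexOn.map_integral_le (μ := ν) (g := Real.exp) (s := Set.univ)
    (f := fun x => -D x) convexOn_exp Real.continuous_exp.continuousOn isClosed_univ
    (Eventually.of_forall fun _ => Set.mem_univ _) hD.neg hE
  rw [integral_neg, hcreutz, ← Real.exp_zero, Real.exp_le_exp] at h
  linarith

/-- **MODEL-FREE ACCEPTANCE BOUND (Bretagnolle–Huber form).**  On any probability space, for any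
measurable `D` with `D`, `e^{−D}` integrable and `∫ e^{−D} dπ = 1`:
`1 − ∫ min(1, e^{−D}) dπ ≤ √(1 − e^{−∫ D dπ})`. -/
theorem one_sub_acceptance_le_sqrt (hDm : Measurable D) (hD : Integrable D ν)
    (hE : Integrable (fun x => Real.exp (-D x)) ν) (hcreutz : ∫ x, Real.exp (-D x) ∂ν = 1) :
    1 - ∫ x, min 1 (Real.exp (-D x)) ∂ν ≤ Real.sqrt (1 - Real.exp (-(∫ x, D x ∂ν))) := by
  -- `s = e^{−D/2}`, `s² = e^{−D}`
  set s : X → ℝ := fun x => Real.exp (-D x / 2) with hs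
  have hs_pos : ∀ x, 0 < s x := fun x => Real.exp_pos _
  have hs_sq : ∀ x, s x ^ 2 = Real.exp (-D x) := by
    intro x
    simp only [hs]
    rw [← Real.exp_nat_mul]
    congr 1
    ring
  have hsm : Measurable s := Real.measurable_exp.comp (hDm.neg.div_const 2)
  -- `s ∈ L²` (since `s² = e^{−D} ∈ L¹`), hence `s ∈ L¹` on a probability space
  have hs2 : MemLp s 2 ν := by
    rw [memLp_two_iff_integrable_sq hsm.aestronglyMeasurable]
    simp_rw [hs_sq]
    exact hE
  have hs1 : Integrable s ν := hs2.integrable one_le_two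
  set b : ℝ := ∫ x, s x ∂ν with hb
  -- the two `L²` factors
  have h1 : MemLp (fun _ : X => (1 : ℝ)) 2 ν := memLp_const 1
  have h1s : MemLp (fun x => 1 - s x) 2 ν := h1.sub hs2
  have hf2 : MemLp (fun x => |1 - s x|) 2 ν := h1s.abs
  have hg2 : MemLp (fun x => 1 + s x) 2 ν := h1.add hs2
  have hf_int_sq : ∫ x, |1 - s x| ^ 2 ∂ν = 2 - 2 * b := by
    have e : ∀ x, |1 - s x| ^ 2 = 1 - 2 * s x + Real.exp (-D x) := by
      intro x; rw [sq_abs, ← hs_sq x]; ring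
    simp_rw [e]
    have iA : Integrable (fun x => 1 - 2 * s x) ν := (integrable_const _).sub (hs1.const_mul _)
    rw [integral_add iA hE, integral_sub (integrable_const _) (hs1.const_mul _),
      integral_const_mul, integral_const, probReal_univ, one_smul, hcreutz]
    ring
  have hg_int_sq : ∫ x, (1 + s x) ^ 2 ∂ν = 2 + 2 * b := by
    have e : ∀ x, (1 + s x) ^ 2 = 1 + 2 * s x + Real.exp (-D x) := by
      intro x; rw [← hs_sq x]; ring
    simp_rw [e]
    have iB : Integrable (fun x => 1 + 2 * s x) ν := (integrable_const _).add (hs1.const_mul _)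
    rw [integral_add iB hE, integral_add (integrable_const _) (hs1.const_mul _),
      integral_const_mul, integral_const, probReal_univ, one_smul, hcreutz]
    ring
  -- Cauchy–Schwarz: `∫ |1 − e^{−D}| = ∫ |1 − s| (1 + s) ≤ √(2 − 2b) √(2 + 2b)`
  have hCS : ∫ x, |1 - Real.exp (-D x)| ∂ν ≤ Real.sqrt (2 - 2 * b) * Real.sqrt (2 + 2 * b) := by
    have e : ∀ x, |1 - Real.exp (-D x)| = |1 - s x| * (1 + s x) := by
      intro x
      rw [← hs_sq x, show 1 - s x ^ 2 = (1 - s x) * (1 + s x) by ring, abs_mul,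
        abs_of_pos (by linarith [hs_pos x] : 0 < 1 + s x)]
    simp_rw [e]
    have h := integral_mul_le_Lp_mul_Lq_of_nonneg (μ := ν) Real.HolderConjugate.two_two
      (Eventually.of_forall fun x => abs_nonneg (1 - s x))
      (Eventually.of_forall fun x => (by linarith [hs_pos x] : (0 : ℝ) ≤ 1 + s x))
      (by rwa [ENNReal.ofReal_ofNat]) (by rwa [ENNReal.ofReal_ofNat])
    have e2 : ∀ y : ℝ, y ^ (2 : ℝ) = y ^ 2 := fun y => Real.rpow_two y
    simp_rw [e2] at h
    rw [hf_int_sq, hg_int_sq, ← Real.sqrt_eq_rpow, ← Real.sqrt_eq_rpow] at h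
    exact h
  -- Jensen: `b ≥ e^{−⟨D⟩/2}`, so `(2 − 2b)(2 + 2b) = 4(1 − b²) ≤ 4(1 − e^{−⟨D⟩})`
  have hbJ : Real.exp (-(∫ x, D x ∂ν) / 2) ≤ b := exp_neg_half_integral_le hD hs1
  have hb0 : 0 < b := (Real.exp_pos _).trans_le hbJ
  have hb2 : Real.exp (-(∫ x, D x ∂ν)) ≤ b ^ 2 := by
    have e : Real.exp (-(∫ x, D x ∂ν)) = Real.exp (-(∫ x, D x ∂ν) / 2) ^ 2 := by
      rw [← Real.exp_nat_mul]; congr 1; ring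
    rw [e]
    exact pow_le_pow_left₀ (Real.exp_pos _).le hbJ 2
  have h22 : 0 ≤ 2 - 2 * b := by
    rw [← hf_int_sq]; exact integral_nonneg fun x => sq_nonneg _
  have hprod : Real.sqrt (2 - 2 * b) * Real.sqrt (2 + 2 * b)
      = 2 * Real.sqrt (1 - b ^ 2) := by
    rw [← Real.sqrt_mul h22, show (2 - 2 * b) * (2 + 2 * b) = 2 ^ 2 * (1 - b ^ 2) by ring,
      Real.sqrt_mul (by norm_num) , Real.sqrt_sq (by norm_num)]
  rw [one_sub_integral_min_eq_half_integral_abs hDm hE hcreutz]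
  calc 1 / 2 * ∫ x, |1 - Real.exp (-D x)| ∂ν ≤ 1 / 2 * (2 * Real.sqrt (1 - b ^ 2)) := by
        rw [← hprod]; exact mul_le_mul_of_nonneg_left hCS (by norm_num)
    _ = Real.sqrt (1 - b ^ 2) := by ring
    _ ≤ Real.sqrt (1 - Real.exp (-(∫ x, D x ∂ν))) := Real.sqrt_le_sqrt (by linarith)

/-- **`1 − ⟨P_acc⟩ ≤ √⟨ΔH⟩`** (the memorable weakening: `1 − e^{−m} ≤ m`). -/
theorem one_sub_acceptance_le_sqrt_mean (hDm : Measurable D) (hD : Integrable D ν)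
    (hE : Integrable (fun x => Real.exp (-D x)) ν) (hcreutz : ∫ x, Real.exp (-D x) ∂ν = 1) :
    1 - ∫ x, min 1 (Real.exp (-D x)) ∂ν ≤ Real.sqrt (∫ x, D x ∂ν) := by
  refine (one_sub_acceptance_le_sqrt hDm hD hE hcreutz).trans (Real.sqrt_le_sqrt ?_)
  have h := Real.add_one_le_exp (-(∫ x, D x ∂ν))
  linarith

end Probability

/-! ## §2 Deterministic reversible proposals: HMC -/

section Involutive

variable {X : Type*} [MeasurableSpace X] {μ : Measure X}

/-- **ACCEPTANCE OF A REVERSIBLE VOLUME-PRESERVING PROPOSAL FROM ITS MEAN ENERGY VIOLATION.**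
`Ψ` a measurable `μ`-preserving involution, `H` measurable with `e^{−H}` and `ΔH e^{−H}` integrable
(`ΔH = H∘Ψ − H`), `Z = ∫ e^{−H} dμ`.  Then the equilibrium acceptance satisfies
`∫ min(1, e^{−ΔH}) e^{−H} dμ ≥ (1 − √(1 − exp(−Z⁻¹∫ ΔH e^{−H} dμ))) · Z`. -/
theorem involutive_acceptance_ge {H : X → ℝ} {Ψ : X → X} (hH : Measurable H) (hΨm : Measurable Ψ)
    (hΨi : Function.Involutive Ψ) (hΨμ : MeasurePreserving Ψ μ μ)
    (hw : Integrable (fun z => Real.exp (-H z)) μ)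
    (hΔ : Integrable (fun z => deltaH H Ψ z * Real.exp (-H z)) μ) (hZ : 0 < ∫ z, Real.exp (-H z) ∂μ) :
    (1 - Real.sqrt (1 - Real.exp (-((∫ z, deltaH H Ψ z * Real.exp (-H z) ∂μ)
        / ∫ z, Real.exp (-H z) ∂μ)))) * ∫ z, Real.exp (-H z) ∂μ
      ≤ ∫ z, min 1 (Real.exp (-deltaH H Ψ z)) * Real.exp (-H z) ∂μ := by
  set Z := ∫ z, Real.exp (-H z) ∂μ with hZdef
  have hΔm : Measurable (deltaH H Ψ) := measurable_deltaH hH hΨm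
  have hwm : Measurable fun z => Real.exp (-H z) := Real.measurable_exp.comp hH.neg
  -- the Gibbs probability measure `ν = Z⁻¹ e^{−H} μ`
  set ν : Measure X := μ.withDensity fun z => ENNReal.ofReal (Real.exp (-H z) / Z) with hν
  have hdens_m : Measurable fun z => ENNReal.ofReal (Real.exp (-H z) / Z) :=
    (hwm.div_const Z).ennreal_ofReal
  haveI : IsProbabilityMeasure ν := by
    refine ⟨?_⟩
    rw [hν, withDensity_apply _ MeasurableSet.univ, Measure.restrict_univ,
      ← ofReal_integral_eq_lintegral_ofReal (hw.div_const Z)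
        (Eventually.of_forall fun z => div_nonneg (Real.exp_pos _).le hZ.le),
      integral_div, div_self hZ.ne', ENNReal.ofReal_one]
  -- integrals against `ν` are `Z⁻¹ ∫ (·) e^{−H} dμ`
  have hint : ∀ f : X → ℝ, ∫ z, f z ∂ν = (∫ z, f z * Real.exp (-H z) ∂μ) / Z := by
    intro f
    rw [hν, integral_withDensity_eq_integral_toReal_smul hdens_m
      (Eventually.of_forall fun _ => ENNReal.ofReal_lt_top), ← integral_div]
    refine integral_congr_ae (Eventually.of_forall fun z => ?_)
    dsimp only
    rw [ENNReal.toReal_ofReal (div_nonneg (Real.exp_pos _).le hZ.le), smul_eq_mul]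
    ring
  have hintegrable : ∀ f : X → ℝ,
      Integrable (fun z => f z * Real.exp (-H z)) μ → Integrable f ν := by
    intro f hf
    rw [hν, integrable_withDensity_iff_integrable_smul' hdens_m
      (Eventually.of_forall fun _ => ENNReal.ofReal_lt_top)]
    have e : (fun z => (ENNReal.ofReal (Real.exp (-H z) / Z)).toReal • f z)
        = fun z => Z⁻¹ * (f z * Real.exp (-H z)) := by
      funext z
      rw [ENNReal.toReal_ofReal (div_nonneg (Real.exp_pos _).le hZ.le), smul_eq_mul]
      ring
    rw [e]
    exact hf.const_mul _
  -- the hypotheses of §1 for `D = ΔH` under `ν`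
  have hE : Integrable (fun z => Real.exp (-deltaH H Ψ z)) ν := by
    refine hintegrable _ ?_
    simp_rw [exp_neg_deltaH_mul_exp_neg H Ψ]
    exact (hΨμ.integrable_comp hw.aestronglyMeasurable).mpr hw |>.congr
      (Eventually.of_forall fun z => rfl)
  have hD : Integrable (deltaH H Ψ) ν := hintegrable _ hΔ
  have hcreutz : ∫ z, Real.exp (-deltaH H Ψ z) ∂ν = 1 := by
    rw [hint, creutz_integral hΨm hΨi hΨμ, div_self hZ.ne']
  have h := one_sub_acceptance_le_sqrt (ν := ν) hΔm hD hE hcreutz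
  rw [hint (fun z => min 1 (Real.exp (-deltaH H Ψ z))), hint (deltaH H Ψ)] at h
  -- `1 − A/Z ≤ √(…)` ⇒ `(1 − √(…)) Z ≤ A`
  have h2 : (1 - Real.sqrt (1 - Real.exp (-((∫ z, deltaH H Ψ z * Real.exp (-H z) ∂μ) / Z))))
      ≤ (∫ z, min 1 (Real.exp (-deltaH H Ψ z)) * Real.exp (-H z) ∂μ) / Z := by linarith
  exact (le_div_iff₀ hZ).1 h2

end Involutive

section Lattice

open Summit.Ventures.LatticeQCDFlow.Scoring

variable {n : ℕ}

/-- **Row 2's lattice HMC**: for a coercive action (`λ > 0`, any real `J`), every step size `δ` and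
trajectory length `N`, PROVIDED the first moment `∫ ΔH e^{−H}` exists (hypothesis `hΔ`; true for
the polynomial leapfrog map, not formalised here): the equilibrium acceptance is at least
`(1 − √(1 − e^{−⟨ΔH⟩})) · Z`. -/
theorem hmc_acceptance_ge {J : Fin (n + 1) → Fin (n + 1) → ℝ} {lam ε K : ℝ} (hε : 0 < ε)
    (hS : ∀ φ : Fin (n + 1) → ℝ, ε * ∑ w, φ w ^ 2 - K ≤ latticePhi4Action J lam φ)
    (δ : ℝ) (N : ℕ)
    (hΔ : Integrable (fun z => hmcDeltaH J lam δ N z * Real.exp (-phi4HmcEnergy J lam z))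
      ((volume : Measure (Fin (n + 1) → ℝ)).prod volume)) :
    (1 - Real.sqrt (1 - Real.exp (-((∫ z, hmcDeltaH J lam δ N z * Real.exp (-phi4HmcEnergy J lam z)
        ∂((volume : Measure (Fin (n + 1) → ℝ)).prod volume))
        / ∫ z, Real.exp (-phi4HmcEnergy J lam z) ∂((volume : Measure (Fin (n + 1) → ℝ)).prod volume)))))
      * ∫ z, Real.exp (-phi4HmcEnergy J lam z) ∂((volume : Measure (Fin (n + 1) → ℝ)).prod volume)
      ≤ ∫ z, min 1 (Real.exp (-hmcDeltaH J lam δ N z)) * Real.exp (-phi4HmcEnergy J lam z)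
          ∂((volume : Measure (Fin (n + 1) → ℝ)).prod volume) :=
  involutive_acceptance_ge (measurable_phi4HmcEnergy J lam) (measurable_hmcProposal J lam δ N)
    (hmcProposal_involutive J lam δ N) (measurePreserving_hmcProposal J lam δ N)
    (integrable_exp_neg_phi4HmcEnergy hε hS) hΔ
    (integral_exp_pos (integrable_exp_neg_phi4HmcEnergy hε hS))

end Lattice


end Summit.Ventures.LatticeQCDFlow.Exactness
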